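import Summits.ResolutionOfSingularities.ResolutionOfSingularities.Theses.PAlteration

/-!
# `ResolutionOfSingularities → Picover` (faithfulness of the crux)

Helper for crux item `stmt-ResolutionOfSingularities-0554` (`PAlteration.Picover`, route
`pAlteration`): the crux is a special case of the summit statement, so `¬ Picover → ¬ summit`
(the route's kill criterion) is formal. Content: a finite cover `g : X ⟶ Y` of a separated
finite-type `k`-scheme `Y` makes `X` a separated finite-type `k`-scheme via `g ≫ f`, and an integral
scheme is reduced; then `ResolutionInChar p` applies to `X`.
-/

set_option linter.dupNamespace false -- mandated namespace of this single-conjunct summit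

open CategoryTheory AlgebraicGeometry

namespace Summit.ResolutionOfSingularities.ResolutionOfSingularities.Theorems.Picover.OfSummit

/-- **The summit implies the crux `Picover`.** If resolution of singularities holds in every prime
characteristic (`ResolutionOfSingularities`), then every integral scheme `X` finite, universally
injective and surjective over a regular integral separated finite-type `k`-scheme `Y` (char `k = p`)
has a resolution: `X → Y → Spec k` is separated, locally of finite type and quasi-compact, and `X`
is reduced. (Regularity of `Y`, universal injectivity and surjectivity of `g` are not used.)
[folklore] -/
theorem picover_of_resolutionOfSingularities : _root_.ResolutionOfSingularities → Summit.ResolutionOfSingularities.ResolutionOfSingularities.Theses.PAlteration.Picover := by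
  intro h p hp k _ _ Y X f g hsep hlft hqc _hY _hYreg hX hfin _hui _hsurj
  have h1 : IsSeparated (g ≫ f) := inferInstance
  have h2 : LocallyOfFiniteType (g ≫ f) := inferInstance
  have h3 : QuasiCompact (g ≫ f) := inferInstance
  exact h p hp k X (g ≫ f) h1 h2 h3 inferInstance

end Summit.ResolutionOfSingularities.ResolutionOfSingularities.Theorems.Picover.OfSummit
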